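import Mathlib
import Summits.ValiantsHypothesis.ValiantsHypothesis.Theorems.SymPencilSymmetrizePermPairsRegularPermify
import Summits.ValiantsHypothesis.ValiantsHypothesis.Theorems.SymPencilSymmetrizePermPairsPermEmbeddingSubOfIrreducible
import Summits.ValiantsHypothesis.ValiantsHypothesis.Theorems.SymPencilSymmetrizePermPairsPermEmbeddingDSub
import Summits.ValiantsHypothesis.ValiantsHypothesis.Theorems.SymPencilSymmetrizePermPairsYoungTwoDegree
import HarnessLib

/-!
# ValiantsHypothesis / SymPencil — crux `SymmetrizePermPairs` (stmt-ValiantsHypothesis-17793),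
# stub `stub_induce`, ASSEMBLY [A3]: PERMIFY OVER A SUBGROUP `H ≤ 𝔖_n × 𝔖_n` AT QUASI-POLYNOMIAL
# COST IN `m` AND THE INDEX `R`, from (D)_H

The `permify_subgroup` branch of the tenure's cut for `stub_induce`
(`stub_induce ⇐ induce_blocks (I1) ∧ permify_subgroup ∧ symmetrize_equivariant (C3)`): an affine
determinantal representation `A` of `per_n` of size `m`, equivariant (exact `GL_m × GL_m` lifts)
under the permutation matrices of the pairs of a subgroup `H ≤ 𝔖_n × 𝔖_n` of index `R`, is replaced
by an affine pencil `A'` of size `m' ≤ 2^{(log₂ m + log₂ R + d)^d}` with `det A' = per_n` on which every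
substitution `x_{ij} ↦ x_{π i, ρ j}`, `(π, ρ) ∈ H`, is undone by conjugation with a PERMUTATION matrix
(`permify_subgroup_of_D`) — for ALL `R`, granted (D)_H (hypothesis verbatim; it is
`permEmbeddingD_sub_of_bounds` [A1] from (GS), (H1)₂, (H2)₂).  Chain: (i)
`conjugationNormalForm_rename_sub`, (ii) `finiteConjugationLift_sub` with the lift group cut down to
`F' = F ∩ (H × GL)` (finite, `PermEmbedding.finite_liftGroup`; first projection `= H`), (iii)
`permEmbedding_sub_of_irreducible` [A2] ((D)_H → (iii″)_H) applied to `F' → 𝔖_n × 𝔖_n`,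
(iv) `exists_permConj_extension`; budget `log₂ m₀ + log₂ n ≤ 2 log₂ m` (`two_mul_add_pow_le`).

Honest framing: conditional assembly for an OPEN stub of an OPEN crux ((D)_H rests on the unlanded
(H1)₂ = piece (K3) and the (C1) seat's (GS)); the symmetric-output core (C3) is untouched;
`VP ≠ VNP` is NOT proved and nothing here is progress on it.  No new definitions, no named facts
(`--supports stmt-ValiantsHypothesis-17793 --as helper`).
-/

noncomputable section

-- `Summit.ValiantsHypothesis.ValiantsHypothesis.…` is the tree's mandated single-conjunct layout
-- (Sub = Summit), so the duplicated namespace component is intended.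
set_option linter.dupNamespace false

namespace Summit.ValiantsHypothesis.ValiantsHypothesis.Theorems.SymPencilEquivariantSdcNotQP

open Literature.Computability.AlgebraicComplexity MvPolynomial Matrix

/-- **Permify over a subgroup at quasi-polynomial cost, from (D)_H.**  Granted (D)_H (hypothesis
`hD`, verbatim the conclusion of `permEmbeddingD_sub_of_bounds`), for every `H ≤ 𝔖_n × 𝔖_n` and
every affine determinantal representation `A` of `per_n` of size `m`, equivariant under the closure
of the permutation matrices of the pairs of `H`, there is an affine pencil `A'` of size
`m' ≤ 2^{(log₂ m + log₂ [𝔖_n × 𝔖_n : H] + d)^d}` with `det A' = per_n` and permutation-conjugation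
lifts `A'(x_{π i, ρ j}) = P_σ A'(x) P_σᵀ` for every `(π, ρ) ∈ H`.  Steps (i) `conjugationNormalForm_rename_sub`,
(ii) `finiteConjugationLift_sub` (+ `F' = F ∩ (H × GL)`), (iii) `permEmbedding_sub_of_irreducible hD`
on `F' → 𝔖_n × 𝔖_n` (image `H`), (iv) `exists_permConj_extension`.  Conditional on (D)_H. [folklore] -/
theorem permify_subgroup_of_D
    (hD : ∃ d : ℕ, ∀ (n M k : ℕ) (G : Type) [Group G] [Finite G]
      (φ : G →* Equiv.Perm (Fin n) × Equiv.Perm (Fin n)) (ρ : G →* GL (Fin k) ℂ),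
      (∀ g : G, φ g = 1 → ∃ c : ℂ, c ^ M = 1 ∧
        (ρ g : Matrix (Fin k) (Fin k) ℂ) = c • (1 : Matrix (Fin k) (Fin k) ℂ)) →
      k ≤ M →
      (∀ W : Submodule ℂ (Fin k → ℂ),
        (∀ g : G, W ≤ W.comap (Matrix.toLin' (ρ g : Matrix (Fin k) (Fin k) ℂ))) → W = ⊥ ∨ W = ⊤) →
      ∃ m' ≤ 2 ^ ((Nat.log 2 M + Nat.log 2 n + Nat.log 2 φ.range.index + d) ^ d),
        ∃ (ι : Matrix (Fin m') (Fin k) ℂ) (p : Matrix (Fin k) (Fin m') ℂ)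
          (τ : G → Equiv.Perm (Fin m')),
          p * ι = 1 ∧ ∀ g : G,
            (τ g).permMatrix ℂ * ι = ι * (ρ g : Matrix (Fin k) (Fin k) ℂ) ∧
            p * (τ g).permMatrix ℂ = (ρ g : Matrix (Fin k) (Fin k) ℂ) * p) :
    ∃ d : ℕ, ∀ (n m : ℕ) (H : Subgroup (Equiv.Perm (Fin n) × Equiv.Perm (Fin n)))
      (A : Matrix (Fin m) (Fin m) (MvPolynomial (Fin n × Fin n) ℂ)),
      IsEquivariantDetRepr (Subgroup.closure {γ : GL (Fin n × Fin n) ℂ |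
        ∃ πρ ∈ H, (γ : Matrix (Fin n × Fin n) (Fin n × Fin n) ℂ) =
          Equiv.Perm.permMatrix ℂ (Equiv.prodCongr πρ.1 πρ.2)}) (perPoly (Fin n) ℂ) A →
      ∃ m' ≤ 2 ^ ((Nat.log 2 m + Nat.log 2 H.index + d) ^ d),
        ∃ A' : Matrix (Fin m') (Fin m') (MvPolynomial (Fin n × Fin n) ℂ),
          IsAffineDetRepr (perPoly (Fin n) ℂ) A' ∧
          ∀ πρ ∈ H, ∃ σ : Equiv.Perm (Fin m'),
            A'.map (MvPolynomial.rename fun ij : Fin n × Fin n => (πρ.1 ij.1, πρ.2 ij.2)) =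
              (σ.permMatrix ℂ).map MvPolynomial.C * A' * ((σ.permMatrix ℂ)ᵀ).map MvPolynomial.C := by
  classical
  obtain ⟨d, hd⟩ := permEmbedding_sub_of_irreducible hD
  refine ⟨2 * d + 2, fun n m H A hA => ?_⟩
  -- `n = deg per_n ≤ m`
  have hnm : n ≤ m := by
    have h := totalDegree_le_of_hasDetRepr_holds
      (show HasDetRepr (perPoly (Fin n) ℂ) m from ⟨A, hA.1⟩)
    rwa [totalDegree_perPoly_holds, Fintype.card_fin] at h
  -- step (i): conjugation normal form, `rename` form, over `H`
  obtain ⟨B, hB, hBJ, hgen⟩ := conjugationNormalForm_rename_sub n m H A hA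
  -- step (ii): finite conjugation lift over `H`, cut down to the pairs of `H`
  obtain ⟨m₀, hm₀, B₀, F, hB₀, hsurj, hscal, hdet, hliftF⟩ :=
    finiteConjugationLift_sub n m H B hB hBJ hgen
  obtain ⟨F', hmemF'⟩ :
      ∃ F' : Subgroup ((Equiv.Perm (Fin n) × Equiv.Perm (Fin n)) × GL (Fin m₀) ℂ),
        ∀ x, x ∈ F' ↔ x ∈ F ∧ x.1 ∈ H :=
    ⟨F ⊓ H.prod ⊤, fun x => by
      rw [Subgroup.mem_inf, Subgroup.mem_prod]
      simp only [Subgroup.mem_top, and_true]⟩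
  have hscal' : ∀ g : GL (Fin m₀) ℂ, ((1 : Equiv.Perm (Fin n) × Equiv.Perm (Fin n)), g) ∈ F' →
      ∃ c : ℂ, (g : Matrix (Fin m₀) (Fin m₀) ℂ) = c • (1 : Matrix (Fin m₀) (Fin m₀) ℂ) :=
    fun g hg => hscal g ((hmemF' _).mp hg).1
  have hdet' : ∀ x ∈ F', Matrix.det (x.2 : Matrix (Fin m₀) (Fin m₀) ℂ) = 1 :=
    fun x hx => hdet x ((hmemF' _).mp hx).1
  haveI : Finite F' := PermEmbedding.finite_liftGroup F' hscal' hdet'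
  -- the projections of `F'`
  let φ : F' →* Equiv.Perm (Fin n) × Equiv.Perm (Fin n) :=
    (MonoidHom.fst _ (GL (Fin m₀) ℂ)).comp F'.subtype
  let ρ : F' →* GL (Fin m₀) ℂ := (MonoidHom.snd (Equiv.Perm (Fin n) × Equiv.Perm (Fin n)) _).comp F'.subtype
  have hφ : ∀ x : F', φ x = ((x : (Equiv.Perm (Fin n) × Equiv.Perm (Fin n)) × GL (Fin m₀) ℂ)).1 :=
    fun x => rfl
  have hρ : ∀ x : F', ρ x = ((x : (Equiv.Perm (Fin n) × Equiv.Perm (Fin n)) × GL (Fin m₀) ℂ)).2 :=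
    fun x => rfl
  have hrange : φ.range = H := by
    ext πρ
    constructor
    · rintro ⟨x, rfl⟩
      rw [hφ]
      exact ((hmemF' _).mp x.2).2
    · intro hπρ
      obtain ⟨g, hg⟩ := hsurj πρ hπρ
      exact ⟨⟨(πρ, g), (hmemF' _).mpr ⟨hg, hπρ⟩⟩, rfl⟩
  have hker : ∀ x : F', φ x = 1 → ∃ c : ℂ,
      (ρ x : Matrix (Fin m₀) (Fin m₀) ℂ) = c • (1 : Matrix (Fin m₀) (Fin m₀) ℂ) := by
    intro x hx
    rw [hφ] at hx
    have hmem : ((1 : Equiv.Perm (Fin n) × Equiv.Perm (Fin n)),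
        ((x : (Equiv.Perm (Fin n) × Equiv.Perm (Fin n)) × GL (Fin m₀) ℂ)).2) ∈ F' := by
      rw [← hx]
      exact x.2
    exact hscal' _ hmem
  have hdetρ : ∀ x : F', Matrix.det (ρ x : Matrix (Fin m₀) (Fin m₀) ℂ) = 1 :=
    fun x => hdet' _ x.2
  -- step (iii): the permutation embedding of `F'`
  obtain ⟨m', hm', ι, p, τ, hpι, hrel⟩ := hd n m₀ F' φ ρ hker hdetρ
  rw [hrange] at hm'
  -- step (iv): extension by the identity, substitutions indexed by `H`
  obtain ⟨A', hA'deg, hA'det, hA'perm⟩ := exists_permConj_extension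
    (fun πρ : H =>
      MvPolynomial.rename fun ij : Fin n × Fin n =>
        ((πρ : Equiv.Perm (Fin n) × Equiv.Perm (Fin n)).1 ij.1,
          (πρ : Equiv.Perm (Fin n) × Equiv.Perm (Fin n)).2 ij.2))
    B₀ hB₀.1 ι p hpι (fun πρ => by
      obtain ⟨g, hg⟩ := hsurj πρ πρ.2
      have hg' : ((πρ : Equiv.Perm (Fin n) × Equiv.Perm (Fin n)), g) ∈ F' :=
        (hmemF' _).mpr ⟨hg, πρ.2⟩
      -- explicit arguments (no `_` pairs: see `permify_regular_of_subgroup`)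
      exact ⟨g, τ ⟨((πρ : Equiv.Perm (Fin n) × Equiv.Perm (Fin n)), g), hg'⟩,
        hliftF ((πρ : Equiv.Perm (Fin n) × Equiv.Perm (Fin n)), g) hg,
        (hrel ⟨((πρ : Equiv.Perm (Fin n) × Equiv.Perm (Fin n)), g), hg'⟩).1,
        (hrel ⟨((πρ : Equiv.Perm (Fin n) × Equiv.Perm (Fin n)), g), hg'⟩).2⟩)
  refine ⟨m', ?_, A', ⟨hA'deg, hA'det.trans hB₀.2⟩, fun πρ hπρ => hA'perm ⟨πρ, hπρ⟩⟩
  -- budget: `log₂ m₀ + log₂ n ≤ 2 log₂ m`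
  have hlog : Nat.log 2 m₀ + Nat.log 2 n + Nat.log 2 H.index + d ≤
      2 * (Nat.log 2 m + Nat.log 2 H.index) + d := by
    have h1 := Nat.log_mono_right (b := 2) hm₀
    have h2 := Nat.log_mono_right (b := 2) hnm
    omega
  calc m' ≤ 2 ^ ((Nat.log 2 m₀ + Nat.log 2 n + Nat.log 2 H.index + d) ^ d) := hm'
    _ ≤ 2 ^ ((2 * (Nat.log 2 m + Nat.log 2 H.index) + d) ^ d) :=
        Nat.pow_le_pow_right (by norm_num) (Nat.pow_le_pow_left hlog d)
    _ ≤ 2 ^ ((Nat.log 2 m + Nat.log 2 H.index + (2 * d + 2)) ^ (2 * d + 2)) :=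
        Nat.pow_le_pow_right (by norm_num) (two_mul_add_pow_le _ _)

/-- **Permify over a subgroup at quasi-polynomial cost, from (GS) and (H1)₂** — the composition
`permify_subgroup_of_D (permEmbeddingD_sub_of_bounds hGS hExt youngFixedVector_two_holds)`:
the `permify_subgroup` branch of `stub_induce` for ALL indices `R`, conditional only on the group
step (GS) (landed pieces + the (C1) seat's assembly) and the two-degree spin dichotomy (H1)₂
(piece (K3)); the Young input (H2)₂ is the landed `YoungBounds.youngFixedVector_two_holds`.
[folklore] -/
theorem permify_subgroup_of_bounds
    (hGS : ∀ (n : ℕ) (I : Subgroup (Equiv.Perm (Fin n) × Equiv.Perm (Fin n))) (k₀ : ℕ),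
      8 < n → 1 ≤ k₀ → 4 * k₀ ≤ n → I.index < n.choose k₀ → 2 * I.index < (n - k₀).factorial →
      ∃ X₁ X₂ : Finset (Fin n), X₁.card < k₀ ∧ X₂.card < k₀ ∧
        ((alternatingGroup {x // x ∉ X₁}).map
            (Equiv.Perm.ofSubtype : Equiv.Perm {x // x ∉ X₁} →* Equiv.Perm (Fin n))).prod
          ((alternatingGroup {x // x ∉ X₂}).map
            (Equiv.Perm.ofSubtype : Equiv.Perm {x // x ∉ X₂} →* Equiv.Perm (Fin n))) ≤ I)
    (hExt : ∃ a₀ : ℕ, ∀ (a b k : ℕ) (E : Type) [Group E] [Finite E]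
      (ψ : E →* ↥(alternatingGroup (Fin a)) × ↥(alternatingGroup (Fin b)))
      (σ : E →* GL (Fin k) ℂ),
      Function.Surjective ψ →
      (∀ g : E, ψ g = 1 → ∃ c : ℂ,
        (σ g : Matrix (Fin k) (Fin k) ℂ) = c • (1 : Matrix (Fin k) (Fin k) ℂ)) →
      min a b ≤ a₀ * (Nat.log 2 k + 1) ∨
        ∃ θ : E →* ℂˣ, ∀ g : E, ψ g = 1 →
          (σ g : Matrix (Fin k) (Fin k) ℂ) = ((θ g : ℂˣ) : ℂ) • (1 : Matrix (Fin k) (Fin k) ℂ)) :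
    ∃ d : ℕ, ∀ (n m : ℕ) (H : Subgroup (Equiv.Perm (Fin n) × Equiv.Perm (Fin n)))
      (A : Matrix (Fin m) (Fin m) (MvPolynomial (Fin n × Fin n) ℂ)),
      IsEquivariantDetRepr (Subgroup.closure {γ : GL (Fin n × Fin n) ℂ |
        ∃ πρ ∈ H, (γ : Matrix (Fin n × Fin n) (Fin n × Fin n) ℂ) =
          Equiv.Perm.permMatrix ℂ (Equiv.prodCongr πρ.1 πρ.2)}) (perPoly (Fin n) ℂ) A →
      ∃ m' ≤ 2 ^ ((Nat.log 2 m + Nat.log 2 H.index + d) ^ d),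
        ∃ A' : Matrix (Fin m') (Fin m') (MvPolynomial (Fin n × Fin n) ℂ),
          IsAffineDetRepr (perPoly (Fin n) ℂ) A' ∧
          ∀ πρ ∈ H, ∃ σ : Equiv.Perm (Fin m'),
            A'.map (MvPolynomial.rename fun ij : Fin n × Fin n => (πρ.1 ij.1, πρ.2 ij.2)) =
              (σ.permMatrix ℂ).map MvPolynomial.C * A' * ((σ.permMatrix ℂ)ᵀ).map MvPolynomial.C :=
  permify_subgroup_of_D
    (permEmbeddingD_sub_of_bounds hGS hExt YoungBounds.youngFixedVector_two_holds)

end Summit.ValiantsHypothesis.ValiantsHypothesis.Theorems.SymPencilEquivariantSdcNotQP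

end
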